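import Literature.NumberTheory.DiophantineGeometry.AVIsogenyTateHomProofs
import Mathlib.RingTheory.Flat.Localization
import HarnessLib

/-!
# Base change of homomorphisms of abelian varieties is injective (faithfulness), also after `ℚ ⊗`

Topic `AlgebraicGeometry/Motives`; namespace `Literature.AlgebraicGeometry.Motives.AbelianVariety`.  **Theorems only** (no
definition, no instance, no named fact, no `sorry`).  Sequel of `AbelianVarietyBaseChange` (`Hom.baseChange L f = f ×_K L`,
the additive functor `baseChangeFunctor K L`) and of `NumberTheory/DiophantineGeometry/AVIsogenyTateHomProofs`
(`AbelianVariety.Hom.baseChange_injective`: `f ↦ f_L` is injective — Görtz–Wedhorn I (2nd ed.), Theorem 14.72 (1): for a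
quasi-compact faithfully flat `S' → S` the functor `X ↦ (X ×_S S', φ_can)` is fully faithful, here `S' = Spec L → S = Spec K`).

* `Hom.baseChange_zero`, `Hom.baseChange_eq_zero_iff`, `Hom.baseChange_ne_zero` — **`f_L = 0 ↔ f = 0`**.
* `lTensor_baseChange_injective` — **`ℚ ⊗ Hom(A, B) → ℚ ⊗ Hom(A_L, B_L)` is injective** (`ℚ` is flat over `ℤ`,
  Mathlib `IsLocalization.flat`), `lTensor_baseChange_ne_zero`.

USE (cells pub-hodgecm ∕ pub-hodgecm2, transposition item (vi), [Liu 2021] Thm. 4.18 (1) at a pinned datum): Liu's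
`Hom_E(A_K, A_μ)_ℚ` is a space of `E`-RATIONAL homomorphisms; a non-zero element of it stays non-zero in
`ℚ ⊗ Hom((A_K)_ℂ, (A_μ)_ℂ)` after base change along `ι₁ : E → ℂ` — the injection (U1) `hcar` of the Albanese-side schema
`Model.reach_of_albanesePin` (binder-2) at the `E`-rational pin `HomK K D_μ := ℚ ⊗ Hom_E(A_K, A_μ)`.

## References

* [GortzWedhorn2020] U. Görtz, T. Wedhorn, *Algebraic Geometry I: Schemes*, 2nd ed. (2020), Theorem 14.72 (1) (faithfully flat
  descent of morphisms: `X ↦ (X ×_S S', φ_can)` fully faithful for `S' → S` quasi-compact faithfully flat; held text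
  `book:gortz2020-algebraic-geometry-i-schemes-2nd-ed` p0581).
-/

set_option autoImplicit false

noncomputable section

universe u

open CategoryTheory
open scoped TensorProduct

namespace Literature.AlgebraicGeometry.Motives.AbelianVariety

variable {K : Type u} [Field K] (L : Type u) [Field L] [Algebra K L] {A B : AbelianVariety K}

/-- `(baseChangeFunctor K L).map f = f_L` (by definition). [folklore] -/
private theorem baseChangeFunctor_map (f : A ⟶ B) : (baseChangeFunctor K L).map f = Hom.baseChange L f := rfl

/-- `0_L = 0` (base change is additive, `baseChangeFunctor` is an additive functor). [cite: GortzWedhorn2020, Theorem 14.72 (1)] -/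
theorem Hom.baseChange_zero : Hom.baseChange L (0 : A ⟶ B) = 0 := by
  rw [← baseChangeFunctor_map]
  exact (baseChangeFunctor K L).map_zero A B

/-- **`f_L = 0 ↔ f = 0`**. [cite: GortzWedhorn2020, Theorem 14.72 (1)] -/
theorem Hom.baseChange_eq_zero_iff (f : A ⟶ B) : Hom.baseChange L f = 0 ↔ f = 0 := by
  constructor
  · intro h
    exact Hom.baseChange_injective L (h.trans (Hom.baseChange_zero L).symm)
  · rintro rfl
    exact Hom.baseChange_zero L

/-- A non-zero homomorphism stays non-zero after base change. [cite: GortzWedhorn2020, Theorem 14.72 (1)] -/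
theorem Hom.baseChange_ne_zero {f : A ⟶ B} (hf : f ≠ 0) : Hom.baseChange L f ≠ 0 :=
  fun h => hf ((Hom.baseChange_eq_zero_iff L f).1 h)

/-- **`ℚ ⊗ Hom(A, B) → ℚ ⊗ Hom(A_L, B_L)` is injective** (`ℚ` is a flat `ℤ`-module, being a localisation; base change is
injective on `Hom`).  This is the passage from `Hom_K(A, B)_ℚ` to `Hom_L(A_L, B_L)_ℚ`. [cite: GortzWedhorn2020, Theorem 14.72 (1)] -/
theorem lTensor_baseChange_injective :
    Function.Injective (LinearMap.lTensor ℚ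
      (((baseChangeFunctor K L).mapAddHom : (A ⟶ B) →+ ((baseChangeFunctor K L).obj A ⟶ (baseChangeFunctor K L).obj B))
        ).toIntLinearMap) := by
  haveI : Module.Flat ℤ ℚ := IsLocalization.flat ℚ (nonZeroDivisors ℤ)
  refine Module.Flat.lTensor_preserves_injective_linearMap _ fun f g h => ?_
  exact Hom.baseChange_injective L h

/-- A non-zero element of `ℚ ⊗ Hom(A, B)` has non-zero image in `ℚ ⊗ Hom(A_L, B_L)`. [cite: GortzWedhorn2020, Theorem 14.72 (1)] -/
theorem lTensor_baseChange_ne_zero {x : ℚ ⊗[ℤ] (A ⟶ B)} (hx : x ≠ 0) :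
    LinearMap.lTensor ℚ
      (((baseChangeFunctor K L).mapAddHom : (A ⟶ B) →+ ((baseChangeFunctor K L).obj A ⟶ (baseChangeFunctor K L).obj B))
        ).toIntLinearMap x ≠ 0 := by
  intro h
  apply hx
  apply lTensor_baseChange_injective L
  rw [h, map_zero]

end Literature.AlgebraicGeometry.Motives.AbelianVariety

end
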